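import Summits.MatrixMultiplication.MatrixMultiplication.Theses.SnSubsetDichotomy
import Summits.MatrixMultiplication.MatrixMultiplication.Theorems.SnSubsetDichotomyDichotomyInduction
import Summits.MatrixMultiplication.MatrixMultiplication.Theorems.SnSubsetDichotomyThresholdSubsetTriplesChainDefs
import Summits.MatrixMultiplication.MatrixMultiplication.Theorems.SnSubsetDichotomyThresholdSubsetTriplesStubCard
import Summits.MatrixMultiplication.MatrixMultiplication.Theorems.SnSubsetDichotomyThresholdSubsetTriplesStubPush

/-!
# Line `interleaved-subsignature-ascent` — skeleton for crux `SnSubsetDichotomy.ThresholdSubsetTriples`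
# (stmt-MatrixMultiplication-10882, route-MatrixMultiplication-SnSubsetDichotomy; crux-plan, round 1)

**Idea (card `interleaved-subsignature-ascent`, ideator 1; triage r1-1: pass, r1-2: pass).** The crux
`X = ThresholdSubsetTriples` (`∀ c > 0, ∀ n₀, ∃ n ≥ n₀`, a TPP triple `S, T, U ⊆ S_n` with
`(n!)^{3/2}·e^{−c√n} < |S||T||U|`) is attacked by a CONSTRUCTION inside one point-stabiliser chain
`S_n ⊃ S_{n−1} ⊃ ⋯ ⊃ 1` with star transpositions as coset representatives: a *direction system*
`D = (D_k)_{k<n}`, `D_k ⊆ {0,…,k}` (`d = k` is the identity letter), defines the *sub-signature class*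
`S_D = P_{n−1} · P_{n−2} ⋯ P_0`, `P_k = {swap d k : d ∈ D_k}` (pointwise product, top level leftmost —
the same set as the ideator's `sigWord` image `{swap(d_{n−1},n−1) ⋯ swap(d_0,0)}`, SketchIdeator1.lean),
of size `|S_D| = ∏_k |D_k|` EXACTLY (Fisher–Yates uniqueness, `stub_card`).  Three systems on ONE chain contain
all Young triples (the refuted transitive sub-family, Disproof §2) and the non-transitive record triples of this
hub (n = 6: 8·16·16 = 2048 = .106·(6!)^{3/2}; n = 8: 96·80·32 = 245760 = .0304·(8!)^{3/2}, kit j013246/j013306,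
re-verified by both triagers and again here from THIS file's definition, `py/check_push.py`).

**The cut (3 registered stubs, one implication path; sorries only inside `stub_*`).**
* `stub_card` (M, provable now): `|subsig D| = ∏_k |D k|` for a direction system — the pointwise product of the
  star pieces is DIRECT (peel the top letter: `σ(last) = d_last`).
* `stub_push` (M, provable now): ONE-LEVEL TOKEN ELIMINATION, exact.  For a token `t`, direction sets
  `E₁ E₂ E₃` and ANY lower sets `L₁ L₂ L₃ ⊆ Stab(t)`:
  `TPP (P_{E₁}·L₁) (P_{E₂}·L₂) (P_{E₃}·L₃) ↔ LevelCondition t E L`, where `LevelCondition` is the TPP relation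
  with the token pushed out of the three lower quotients `q₁ q₂ q₃` (`q·swap(e,t) = swap(q e,t)·q` for `q t = t`):
  `swap(e₁,t) swap(q₁e₁',t) swap(q₁e₂,t) swap(q₁q₂e₂',t) swap(q₁q₂e₃,t) swap(q₁q₂q₃e₃',t) · q₁q₂q₃ = 1 ⇒ trivial`.
  The token occurs ONLY in the six-letter star word; the word fixes `t` iff the token's itinerary closes
  (0, 2 or 3 of the three blocks move `t`), and then the relation is a TWISTED relation
  `q₁q₂q₃ = (star word)⁻¹ ∈ {permutations of support ≤ 6 on images of direction points}` in `Stab(t) ≅ S_n` —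
  the "finite list of twisted-TPP conditions on the lower triple" of the card's Transfer (b), made a theorem.
  Sanity: TPP ⇔ LevelCondition agrees on 190/190 random instances (chain lowers and arbitrary lower subsets of
  `Stab(t)`, TPP-true and -false) and on the n = 6 optimum (`py/check_push.py`).
* `stub_design` (XL, OPEN — the load-bearing bet; = the card's C⁺ restated at the crux's own slack, triage r1-1):
  for every `c > 0`, cofinally in `n`, three direction systems on `n+1` points whose TOP level passes
  `LevelCondition` over the three lower chain classes (⇔ the chain triple has the TPP, by `stub_push`) and whose
  LEVEL VOLUMES satisfy `((n+1)!)^{3/2} e^{−c√(n+1)} < ∏_k |D_A,k||D_B,k||D_C,k|`, i.e.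
  `Σ_k log(1/η_k) < c√(n+1)`, `η_k := |D_A,k||D_B,k||D_C,k|/(k+1)^{3/2}` (the ascent inequality).

The sorry-free glue `ThresholdSubsetTriples_of : ThresholdSubsetTriples` (no hypotheses): `subsig_succ`
(`S_D = P_top · S_{D,<n}`, definitional), `subsigBelow_apply_of_le` (lower classes fix the top point, proved),
`stub_push.2`, `stub_card` ×3 and `Finset.prod_mul_distrib`.  Calibration lemma (proved, ported from the ideator's
sketch): `starPiece_tpp_of_disjoint` — pairwise disjoint direction sets give a level-TPP triple of star pieces
(the bottom case `L = {1}` of `LevelCondition`, `levelCondition_one_of_disjoint`).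

**Disproof used** (`Cruxes/ThresholdSubsetTriples/Disproof.lean`, cdisprove v4, NO KILL; read at start):
`thresholdSubsetTriples_false_without_pos` / `not_beats_zero` — `stub_design` keeps `0 < c` and asks for volume
strictly below packing (every recorded chain optimum respects packing: 2048 < 19318 at n = 6);
`thresholdSubsetTriplesWithoutCofinal_holds` — `stub_design` is cofinal in `n` (`∀ n₀ ∃ n ≥ n₀`), finite data are
shape evidence only; REFUTED STRENGTHENING `not_thresholdYoungTriples` — no stub restricts to Young = transitive
direction systems (`D_k = {j ≤ k : j ∼ k}`); the line needs and the data show NON-transitive systems (hub {0,1,2}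
reused at several levels); §4 `thresholdSubsetTriples_iff_balanced` / `card_window_of_beats` — chain classes are
tuned per level, and a witness of `stub_design` is automatically in the balanced window; §4b `…_iff_rooted` —
`1 ∈ S_D` iff every level carries its identity letter, NOT assumed (the n = 6 optimum has the constant letter (45)
at level 5); §5 `thresholdSubsetTriplesPairwise_holds` / `rootedTriple_not_tpp` — `LevelCondition` is the genuinely
three-fold condition (all of `q₁, q₂, q₃` and all six letters enter one relation), not pairwise data; §3 slice rank
— void in characteristic 0, open modularly (crux 8302's line); a construction is untouched.  No `_false_without_`
theorem constrains a hypothesis this line drops (it drops none); the one LANDED negative file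
`Theorems/ThresholdSubsetTriples/Negative/Packing.lean` (p83440: §0–§1, `not_beats_zero`,
`thresholdSubsetTriples_false_without_pos`, `…WithoutCofinal_holds`, `…WithoutTPP_holds`) was read and is answered by
`design_false_at_scale_zero`: the `c = 0` strengthening of `stub_design` is false — derived through `stub_push` +
`stub_card` from the packing theorem `Theorems.dichotomyInduction_card_le_rpow`, of which the landed `not_beats_zero` is
the three-line corollary (re-derived inline: the olean of `Negative.Packing` had not reached the farm at authoring time,
`lean check` rc 75 `unbuilt` ×5; swap the import for `…Theorems.ThresholdSubsetTriples.Negative.Packing` once built) —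
so `0 < c` is load-bearing in the stub as in the crux, and every design has `∏_k η_k ≤ 1`;
`ledger negatives --problem MatrixMultiplication` (2026-08-16: stmt-7612
LevelTwoBeatsCubes, 9732/9721 AlgebraicSTPPDichotomy line/frame designs, 8036 DesignFlattening) — unrelated to
subsets of `S_n`; no stub is an instance of a refuted statement, of the crux, or of the summit.
-/

namespace Summit.MatrixMultiplication.MatrixMultiplication.Cruxes.ThresholdSubsetTriples.InterleavedSubsignatureAscent

open scoped Pointwise BigOperators
open Literature.Combinatorics.Additive
open Summit.MatrixMultiplication.MatrixMultiplication.Theses.SnSubsetDichotomy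
-- the line's vocabulary (starPiece, LevelCondition, IsDirectionSystem, subsigBelow, subsig, …) and the LANDED
-- stubs `stub_card` (p96986), `stub_push` (p97162) live in the Theorems namespace:
open Summit.MatrixMultiplication.MatrixMultiplication.Theorems.ThresholdSubsetTriples

set_option linter.dupNamespace false
set_option autoImplicit false

/-! ## Objects — LANDED: `Theorems/SnSubsetDichotomyThresholdSubsetTriplesChainDefs.lean` (p96122: `starPiece`,
`swap_left_injective`, `card_starPiece`, `mem_starPiece`, `mul_swap_of_apply_eq`, `LevelCondition`, `IsDirectionSystem`,
`subsigBelow`, `subsig`, `subsigBelow_apply_of_le`, `subsigBelow_apply_last`, `subsig_succ`), imported and opened above. -/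

/-! ## The three stubs -/

/-! **Stub 1 `stub_card` — LANDED** (p96986, `Theorems/SnSubsetDichotomyThresholdSubsetTriplesStubCard.lean`,
worker of wave 1): `stub_card (D) (hD : IsDirectionSystem D) : (subsig D).card = ∏ k, (D k).card`, used below by name. -/

/-! **Stub 2 `stub_push` — LANDED** (p97162, `Theorems/SnSubsetDichotomyThresholdSubsetTriplesStubPush.lean`,
worker of wave 1): `stub_push t E₁ E₂ E₃ L₁ L₂ L₃ h₁ h₂ h₃ : TripleProductProperty (starPiece E₁ t * L₁) (starPiece E₂ t * L₂)
(starPiece E₃ t * L₃) ↔ LevelCondition t E₁ E₂ E₃ L₁ L₂ L₃`, used below by name. -/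

/-- **Stub 3 — THE DESIGN (size XL; OPEN — the load-bearing bet of the line; = the card's C⁺
`SubsignatureThreshold` restated at the crux's own slack `e^{−c√n}`, triage r1-1, so that the line does not
have to refute `PolynomialSlack` (crux 8306) en route).**  For every `c > 0`, cofinally in `n`, there are three
direction systems `D_A, D_B, D_C` on `n+1` points such that (i) the TOP level passes the token-eliminated test
`LevelCondition (last) (D_A last) (D_B last) (D_C last)` over the three lower chain classes
`subsigBelow D_X n ⊆ Stab(last)` — by `stub_push` exactly the TPP of `(S_{D_A}, S_{D_B}, S_{D_C})` — and (ii) the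
LEVEL VOLUMES beat the threshold: `((n+1)!)^{3/2}·e^{−c√(n+1)} < ∏_{k ≤ n} |D_A,k|·|D_B,k|·|D_C,k|`, i.e. the
ascent inequality `Σ_k log(1/η_k) < c·√(n+1)` with level efficiencies `η_k = |D_A,k||D_B,k||D_C,k|/(k+1)^{3/2}`.
Why it might hold: chain systems are entropy-exact (stub 1), host-free and contain strictly more than the Young
family; level pieces may exceed the fair share `(k+1)^{3/2}` (disjoint directions give up to `((k+1)/3)^3`,
`starPiece_tpp_of_disjoint`), so the budget can be moved between levels; on first search chain triples are the
largest TPP triples recorded on this hub at n = 7, 8 (ratio .0572, .0304 vs best Young .029, .0091 and the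
hyperoctahedral-subset optimum .0182 at n = 8), nested as towers with η_5,6,7 = .72, .68, .65 (card data (v),
kit j013246/j013306).  Why it might fail (triage r1-1/r1-2 doubts, verbatim in substance): X needs GEOMETRIC-MEAN
level efficiency → 1 (`Σ_{k<n} log(1/η_k) = o(√n)`), while every family on the hub has per-point efficiency
FALLING with n (.744 → .646 for n = 4..8) and a single optimum saturates (η_8 = .40, kit j013745); nothing in the
card is a mechanism forcing η_k → 1 — it is a search space with an exact size formula and a local certificate;
an entropy (Shearer-type) inequality for chain PAIRS `GM_k(|D_A,k||D_B,k|/(k+1)) ≤ e^{−Ω(1)}` would kill it (none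
found by ideator or triagers; the n = 6 optimum's pair (T,U) has GM .84 > e^{−1/2}).  NECESSARY CONDITIONS any
witness meets (design rules, not stubs): level-TPP of the three top star pieces (take `a = a'`, … in
`LevelCondition`); pair packing `|S_X||S_Y| ≤ (n+1)!` for each pair, so `GM_k(|D_X,k||D_Y,k|/(k+1)) ≤ 1`; the
balanced window of Disproof §4b.  FIRST TEST (both triagers): the card's kill test — diverse-beam (≥ 30 live
states) tower push recording max η_9, η_10 against the triangle's level efficiency ≈ e^{−2}·const; KILL the line if
it falls below from k = 8 on.  MILESTONE short of the stub (triage r1-2): a chain family with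
`GM_k(η_k) ≥ e^{−3/2}(1+δ)` (super-Young) — already new.
[BlasiakChurchCohnGrochowUmans2017 = arXiv:1712.02302 Thm 4.1/4.2, §5 (subsets question); CohnUmans2003 §7
(triangle construction); Neumann2011; HedtkeMurthy arXiv:1104.5097, Hedtke arXiv:1107.5973 (greedy TPP search
baselines); evidence on the item: kit j013246, j013306, j013745, j013943; card §§(v),(f),(h); TRIAGE-r1-1/2] -/
theorem stub_design :
    ∀ c : ℝ, 0 < c → ∀ n₀ : ℕ, ∃ n ≥ n₀, ∃ DA DB DC : Fin (n + 1) → Finset (Fin (n + 1)),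
      IsDirectionSystem DA ∧ IsDirectionSystem DB ∧ IsDirectionSystem DC ∧
      LevelCondition (Fin.last n) (DA (Fin.last n)) (DB (Fin.last n)) (DC (Fin.last n))
        (subsigBelow DA n) (subsigBelow DB n) (subsigBelow DC n) ∧
      ((n + 1).factorial : ℝ) ^ ((3 : ℝ) / 2) * Real.exp (-(c * Real.sqrt ((n + 1 : ℕ) : ℝ))) <
        ((∏ k : Fin (n + 1), ((DA k).card * (DB k).card * (DC k).card) : ℕ) : ℝ) := by
  sorry

/-! ## Calibration (proved): the bottom case of the level condition -/

section Calibration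

variable {α : Type*} [DecidableEq α] [Fintype α]

omit [Fintype α] in
/- token calculus, one level (ported verbatim from SketchIdeator1.lean, ideator 1): a pair-quotient of star
transpositions is trivial or parks the token inside its own direction set, and fixes every point outside its
direction set and `t`. -/
private theorem pair_fixes (D : Finset α) {x x' : α} (t z : α) (hx : x ∈ D) (hx' : x' ∈ D)
    (hz : z ∉ D) (hzt : z ≠ t) : (Equiv.swap x t * Equiv.swap x' t) z = z := by
  have hzx : z ≠ x := fun h => hz (h ▸ hx)
  have hzx' : z ≠ x' := fun h => hz (h ▸ hx')
  simp [Equiv.Perm.mul_apply, Equiv.swap_apply_of_ne_of_ne hzx' hzt, Equiv.swap_apply_of_ne_of_ne hzx hzt]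

omit [Fintype α] in
private theorem pair_dichotomy (D : Finset α) {x x' : α} (t : α) (hx : x ∈ D) (hx' : x' ∈ D) :
    Equiv.swap x t * Equiv.swap x' t = 1 ∨
      ((Equiv.swap x t * Equiv.swap x' t) t ∈ D ∧ (Equiv.swap x t * Equiv.swap x' t) t ≠ t) := by
  by_cases hxx : x' = x
  · left; subst hxx; ext y; simp
  by_cases hx't : x' = t
  · right
    rw [hx't, Equiv.swap_self]
    simp only [Equiv.Perm.mul_apply, Equiv.refl_apply, Equiv.swap_apply_right]
    exact ⟨hx, fun h => hxx (hx't.trans h.symm)⟩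
  · right
    have h1 : (Equiv.swap x t * Equiv.swap x' t) t = x' := by
      rw [Equiv.Perm.mul_apply, Equiv.swap_apply_right, Equiv.swap_apply_of_ne_of_ne hxx hx't]
    rw [h1]; exact ⟨hx', hx't⟩

/-- LEVEL LEMMA (ideator 1, `levelTPP_of_disjoint`, proved; restated for `starPiece`): three pairwise disjoint
direction sets at a common token give a TPP triple of star pieces — the case `L₁ = L₂ = L₃ = {1}` of
`LevelCondition`, and the reason level products up to `((k+1)/3)^3 ≫ (k+1)^{3/2}` are available at a single
level.  (The shared pattern `E₁ = {t,x}, E₂ = {t,y}, E₃ = {x,y}` is NOT TPP, kit j013246: "pairwise |∩| ≤ 1"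
would not suffice.) -/
theorem starPiece_tpp_of_disjoint (t : α) (DA DB DC : Finset α)
    (hAB : Disjoint DA DB) (hBC : Disjoint DB DC) (hAC : Disjoint DA DC) :
    TripleProductProperty (starPiece DA t) (starPiece DB t) (starPiece DC t) := by
  intro s hs s' hs' u hu u' hu' v hv v' hv' E
  obtain ⟨a, ha, rfl⟩ := Finset.mem_image.1 hs
  obtain ⟨a', ha', rfl⟩ := Finset.mem_image.1 hs'
  obtain ⟨b, hb, rfl⟩ := Finset.mem_image.1 hu
  obtain ⟨b', hb', rfl⟩ := Finset.mem_image.1 hu'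
  obtain ⟨c, hc, rfl⟩ := Finset.mem_image.1 hv
  obtain ⟨c', hc', rfl⟩ := Finset.mem_image.1 hv'
  simp only [Equiv.swap_inv] at E
  have dAB : ∀ z, z ∈ DB → z ∉ DA := fun z hzB hzA => Finset.disjoint_left.1 hAB hzA hzB
  have dAC : ∀ z, z ∈ DC → z ∉ DA := fun z hzC hzA => Finset.disjoint_left.1 hAC hzA hzC
  have dBC : ∀ z, z ∈ DC → z ∉ DB := fun z hzC hzB => Finset.disjoint_left.1 hBC hzB hzC
  set PA := Equiv.swap a t * Equiv.swap a' t with hPA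
  set PB := Equiv.swap b t * Equiv.swap b' t with hPB
  set PC := Equiv.swap c t * Equiv.swap c' t with hPC
  have E' : PA * PB * PC = 1 := by simpa [hPA, hPB, hPC, mul_assoc] using E
  have hC1 : PC = 1 := by
    rcases pair_dichotomy DC t hc hc' with h | ⟨hmem, hne⟩
    · exact h
    · exfalso
      have hz := congrArg (fun p : Equiv.Perm α => p t) E'
      simp only [Equiv.Perm.mul_apply, Equiv.Perm.one_apply] at hz
      rw [pair_fixes DB t _ hb hb' (dBC _ hmem) hne, pair_fixes DA t _ ha ha' (dAC _ hmem) hne] at hz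
      exact hne hz
  rw [hC1, mul_one] at E'
  have hB1 : PB = 1 := by
    rcases pair_dichotomy DB t hb hb' with h | ⟨hmem, hne⟩
    · exact h
    · exfalso
      have hz := congrArg (fun p : Equiv.Perm α => p t) E'
      simp only [Equiv.Perm.mul_apply, Equiv.Perm.one_apply] at hz
      rw [pair_fixes DA t _ ha ha' (dAB _ hmem) hne] at hz
      exact hne hz
  rw [hB1, mul_one] at E'
  have key : ∀ x x' : α, Equiv.swap x t * Equiv.swap x' t = 1 → Equiv.swap x t = Equiv.swap x' t :=
    fun x x' h => by
      have := congrArg (· * Equiv.swap x' t) h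
      simpa [mul_assoc] using this
  exact ⟨key _ _ E', key _ _ hB1, key _ _ hC1⟩

/-- The bottom case of the certificate: with trivial lower sets `{1}` the level condition IS the level-TPP of the
three star pieces, hence holds for pairwise disjoint direction sets (non-vacuity of `LevelCondition`). -/
theorem levelCondition_one_of_disjoint (t : α) (DA DB DC : Finset α)
    (hAB : Disjoint DA DB) (hBC : Disjoint DB DC) (hAC : Disjoint DA DC) :
    LevelCondition t DA DB DC {1} {1} {1} := by
  intro e₁ he₁ e₁' he₁' e₂ he₂ e₂' he₂' e₃ he₃ e₃' he₃' a ha a' ha' b hb b' hb' c hc c' hc' hrel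
  simp only [Finset.mem_singleton] at ha ha' hb hb' hc hc'
  subst ha ha' hb hb' hc hc'
  simp only [mul_one, inv_one, Equiv.Perm.one_apply] at hrel
  have hT := starPiece_tpp_of_disjoint t DA DB DC hAB hBC hAC
    (Equiv.swap e₁ t) (Finset.mem_image_of_mem _ he₁) (Equiv.swap e₁' t) (Finset.mem_image_of_mem _ he₁')
    (Equiv.swap e₂ t) (Finset.mem_image_of_mem _ he₂) (Equiv.swap e₂' t) (Finset.mem_image_of_mem _ he₂')
    (Equiv.swap e₃ t) (Finset.mem_image_of_mem _ he₃) (Equiv.swap e₃' t) (Finset.mem_image_of_mem _ he₃')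
    (by simpa [Equiv.swap_inv, mul_assoc] using hrel)
  obtain ⟨h1, h2, h3⟩ := hT
  exact ⟨⟨swap_left_injective t h1, rfl⟩, ⟨swap_left_injective t h2, rfl⟩, ⟨swap_left_injective t h3, rfl⟩⟩

end Calibration

/-! ## Checked against the landed Negative lemma (`Theorems/ThresholdSubsetTriples/Negative/Packing.lean`) -/

/-- The `c = 0` strengthening of `stub_design` is REFUTED by the landed negative lemma
`Theorems.ThresholdSubsetTriples.Negative.not_beats_zero` (p83440; packing: no TPP triple beats `(n!)^{3/2}`;
Disproof §1 `thresholdSubsetTriples_false_without_pos`): through `stub_push` and `stub_card` a scale-`0` design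
would be a TPP triple of chain classes beating the packing bound.  `not_beats_zero` is a three-line corollary of
the tree theorem `Theorems.dichotomyInduction_card_le_rpow` and is re-derived from it inline here (the olean of
`Negative.Packing` had not reached the farm at authoring time: `lean check` rc 75 `unbuilt` ×5, 06:17–06:24Z).
So `0 < c` is load-bearing in `stub_design` exactly as in the crux, and every design has `∏_k η_k ≤ 1`
(level efficiencies cannot all exceed `1`) — the design rule "budget moved between levels, never created". -/
theorem design_false_at_scale_zero :
    ¬ (∀ n₀ : ℕ, ∃ n ≥ n₀, ∃ DA DB DC : Fin (n + 1) → Finset (Fin (n + 1)),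
      IsDirectionSystem DA ∧ IsDirectionSystem DB ∧ IsDirectionSystem DC ∧
      LevelCondition (Fin.last n) (DA (Fin.last n)) (DB (Fin.last n)) (DC (Fin.last n))
        (subsigBelow DA n) (subsigBelow DB n) (subsigBelow DC n) ∧
      ((n + 1).factorial : ℝ) ^ ((3 : ℝ) / 2) * Real.exp (-(0 * Real.sqrt ((n + 1 : ℕ) : ℝ))) <
        ((∏ k : Fin (n + 1), ((DA k).card * (DB k).card * (DC k).card) : ℕ) : ℝ)) := by
  intro h
  obtain ⟨n, -, DA, DB, DC, hA, hB, hC, hL, hvol⟩ := h 0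
  have hT : TripleProductProperty (subsig DA) (subsig DB) (subsig DC) := by
    rw [subsig_succ DA, subsig_succ DB, subsig_succ DC]
    exact (stub_push (Fin.last n) (DA (Fin.last n)) (DB (Fin.last n)) (DC (Fin.last n))
      (subsigBelow DA n) (subsigBelow DB n) (subsigBelow DC n)
      (subsigBelow_apply_last DA hA) (subsigBelow_apply_last DB hB) (subsigBelow_apply_last DC hC)).2 hL
  have hpack := Summit.MatrixMultiplication.MatrixMultiplication.Theorems.dichotomyInduction_card_le_rpow hT
  rw [stub_card DA hA, stub_card DB hB, stub_card DC hC] at hpack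
  have key : (∏ k : Fin (n + 1), ((DA k).card * (DB k).card * (DC k).card)) =
      (∏ k, (DA k).card) * (∏ k, (DB k).card) * ∏ k, (DC k).card := by
    rw [Finset.prod_mul_distrib, Finset.prod_mul_distrib]
  rw [← key] at hpack
  rw [zero_mul, neg_zero, Real.exp_zero, mul_one] at hvol
  exact absurd hvol (not_lt.2 hpack)

/-! ## Glue (sorry-free): the crux from the three stubs -/

/-- **`ThresholdSubsetTriples` from the line** (no hypotheses; uses only the three stubs and the proved
helpers): take the design of `stub_design` at `n+1 ≥ n₀` points, read off the TPP of its three chain classes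
from the top-level condition by `stub_push` (the lower classes fix the top point, `subsigBelow_apply_last`;
`subsig_succ`), and convert level volumes into cardinalities by `stub_card`. -/
theorem ThresholdSubsetTriples_of : ThresholdSubsetTriples := by
  intro c hc n₀
  obtain ⟨n, hn, DA, DB, DC, hA, hB, hC, hL, hvol⟩ := stub_design c hc n₀
  refine ⟨n + 1, le_trans hn (Nat.le_succ n), subsig DA, subsig DB, subsig DC, ?_, ?_⟩
  · rw [subsig_succ DA, subsig_succ DB, subsig_succ DC]
    exact (stub_push (Fin.last n) (DA (Fin.last n)) (DB (Fin.last n)) (DC (Fin.last n))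
      (subsigBelow DA n) (subsigBelow DB n) (subsigBelow DC n)
      (subsigBelow_apply_last DA hA) (subsigBelow_apply_last DB hB) (subsigBelow_apply_last DC hC)).2 hL
  · rw [stub_card DA hA, stub_card DB hB, stub_card DC hC]
    have key : (∏ k : Fin (n + 1), ((DA k).card * (DB k).card * (DC k).card)) =
        (∏ k, (DA k).card) * (∏ k, (DB k).card) * ∏ k, (DC k).card := by
      rw [Finset.prod_mul_distrib, Finset.prod_mul_distrib]
    rw [← key]
    exact hvol

end Summit.MatrixMultiplication.MatrixMultiplication.Cruxes.ThresholdSubsetTriples.InterleavedSubsignatureAscent
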